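import Literature.NumberTheory.Transcendental.ExtrapolationBound
import HarnessLib

/-!
# Baker's method on `M_κ`: vanishing at the new points

Topic: `Literature/NumberTheory/Transcendental`. Plan item W4/S5(f, combination) of the unit
`provefact-Literature.NumberTheory.Transcendental.H-b596640137`. We name the constants of the
theta growth (`PkappaThetaGrowth.exists_norm_theta_le`) and of the lower bound for the base theta
function at the points `s·v` (`ThetaBaseLowerBound.exists_theta_baseIdx_ge`), and combine the
extrapolation estimate (`ExtrapolationBound.lean`) with the inductive step at a point
(`PointStep.lean`): under the explicit numerical condition `NumCond` on the parameters, the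
auxiliary form vanishes to order `≥ T'` along `𝔟` at all points `s·v`, `s ≤ S₁`
(`BakerData.vanishesAlong_newPoints`) — the input of Philippon's zero estimate
(`PhilipponZeroEstimateStd.lean`).

## References

* A. Baker, G. Wüstholz, *Logarithmic Forms and Diophantine Geometry*, CUP 2007, §6.8 (p. 119).
-/

noncomputable section

open Complex MvPolynomial Finset NumberField
open scoped PeriodPair

namespace Literature.NumberTheory.Transcendental

namespace GaGmE

namespace Std

variable {β γ δ : Type} [Fintype β] [Fintype γ] [Fintype δ] [DecidableEq γ]

/-! ### The constants -/

section Growth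

variable (L : PeriodPair) (κM : δ → γ → Kbar)

/-- **The theta growth constant** `C_Θ ≥ 0`: `|Θ_J(w)| ≤ e^{C_Θ(1 + ‖w‖²)}`. [folklore] -/
def thetaGrowthC : ℝ := (exists_norm_theta_le (L := L) (κM := κM) (β := β)).choose

/-- The defining property of `C_Θ`. [folklore] -/
theorem thetaGrowthC_spec : 0 ≤ thetaGrowthC (β := β) L κM ∧
    ∀ (J : Option β × ThetaIdx γ δ) (w : β ⊕ (γ ⊕ δ) → ℂ),
      ‖theta L κM J w‖ ≤ Real.exp (thetaGrowthC (β := β) L κM * (1 + ‖w‖ ^ 2)) :=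
  (exists_norm_theta_le (L := L) (κM := κM) (β := β)).choose_spec

end Growth

namespace BakerData

variable [DecidableEq β] [DecidableEq δ] (B : BakerData β γ δ)

/-- **The constant `c_Θ > 0`** of the lower bound `c_Θ e^{-C'_Θ(1+s²)} ≤ |Θ_{J₀(c_s)}(s·v)|`. [folklore] -/
def thetaLowc : ℝ := B.exists_theta_baseIdx_ge.choose

/-- **The constant `C'_Θ ≥ 0`** of the lower bound. [folklore] -/
def thetaLowC : ℝ := B.exists_theta_baseIdx_ge.choose_spec.2.choose

omit [DecidableEq β] [DecidableEq δ] in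
/-- The defining properties of `c_Θ, C'_Θ`. [folklore] -/
theorem thetaLow_spec : 0 < B.thetaLowc ∧ 0 ≤ B.thetaLowC ∧ ∀ s : ℕ,
    B.thetaLowc * Real.exp (-(B.thetaLowC * (1 + (s : ℝ) ^ 2))) ≤
      ‖theta B.L B.κM (baseIdx (B.cAt s)) ((s : ℂ) • B.v)‖ :=
  ⟨B.exists_theta_baseIdx_ge.choose_spec.1, B.exists_theta_baseIdx_ge.choose_spec.2.choose_spec.1,
    B.exists_theta_baseIdx_ge.choose_spec.2.choose_spec.2⟩

/-! ### The numerical condition and the vanishing at the new points -/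

/-- **The numerical condition** on the parameters `(D', T, S₀, S₁, T', R)` and the coefficient
vector `ξ` under which extrapolation + Liouville force the vanishing at the new points: for all
`s ≤ S₁`, `k < T'`,
`k!·(#U·H_ξ·e^{C_Θ(1+(R‖v‖+kX)²)})^{D}·(2(s+S₀)/R)^{(T-k)(S₀+1)} · |d_s|^E (|d_s|^E Λ_{s,k})^{h-1}
  < (c_Θ e^{-C'_Θ(1+s²)})^{D}` (`D = nD'`, `E = E(D,k)`, `Λ` = `lineValBound`). [folklore] -/
def NumCond {D' : ℕ} (ξ : UIdx β γ δ D' → 𝓞 B.K) (T S₀ S₁ T' : ℕ) (R : ℝ) : Prop :=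
  ∀ s : ℕ, s ≤ S₁ → ∀ k : ℕ, k < T' →
    (k.factorial : ℝ) * (Fintype.card (UIdx β γ δ D') * B.houseXi ξ *
        Real.exp (thetaGrowthC (β := β) B.L B.κM * (1 + (R * ‖B.v‖ + k * B.dirNorm) ^ 2)) ^
          (Fintype.card (β ⊕ (γ ⊕ δ)) * D')) *
      (2 * ((s : ℝ) + S₀) / R) ^ ((T - k) * (S₀ + 1)) *
      (|(B.dAt s : ℝ)| ^ B.expE (Fintype.card (β ⊕ (γ ⊕ δ)) * D') k *
        (|(B.dAt s : ℝ)| ^ B.expE (Fintype.card (β ⊕ (γ ⊕ δ)) * D') k * B.lineValBound ξ s k) ^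
          (B.gens.h - 1)) <
    (B.thetaLowc * Real.exp (-(B.thetaLowC * (1 + (s : ℝ) ^ 2)))) ^ (Fintype.card (β ⊕ (γ ⊕ δ)) * D')

/-- **Vanishing at the new points.** If `v ∈ 𝔟`, the auxiliary form `F_P` (`P = homog D (QOf ξ)`)
vanishes to order `≥ T` along `𝔟` at `0, v, …, S₀v`, `R ≥ 2(S₁ + S₀)`, `R > 0`, and the numerical
condition holds, then `F_P` vanishes to order `≥ T'` along `𝔟` at `s·v` for all `s ≤ S₁`.
[cite: BakerWustholz2007, §6.8 (p. 119)] -/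
theorem vanishesAlong_newPoints (hv : B.v ∈ B.bSpan) {D' : ℕ} (ξ : UIdx β γ δ D' → 𝓞 B.K)
    {T S₀ S₁ T' : ℕ} {R : ℝ} (hR0 : 0 < R) (hR : 2 * ((S₁ : ℝ) + S₀) ≤ R)
    (hvan : ∀ s₀ : ℕ, s₀ ≤ S₀ → VanishesAlong B.bSpan (thetaEval B.L B.κM (B.auxForm ξ)) ((s₀ : ℂ) • B.v) T)
    (hnum : B.NumCond ξ T S₀ S₁ T' R) {s : ℕ} (hs : s ≤ S₁) :
    VanishesAlong B.bSpan (thetaEval B.L B.κM (B.auxForm ξ)) ((s : ℂ) • B.v) T' := by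
  obtain ⟨hC0, hC⟩ := thetaGrowthC_spec (β := β) B.L B.κM
  obtain ⟨hc0, hC'0, hlow⟩ := B.thetaLow_spec
  refine B.vanishesAlong_of_small ξ s T' fun k hk cg hcg => ?_
  have hRs : 2 * ((s : ℝ) + S₀) ≤ R := by
    have : (s : ℝ) ≤ S₁ := by exact_mod_cast hs
    linarith
  have hφ := B.norm_extrapFun_grid_le hC0 hC hv ξ hvan hcg s hR0 hRs
  have hΛ : 0 ≤ |(B.dAt s : ℝ)| ^ B.expE (Fintype.card (β ⊕ (γ ⊕ δ)) * D') k *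
      (|(B.dAt s : ℝ)| ^ B.expE (Fintype.card (β ⊕ (γ ⊕ δ)) * D') k * B.lineValBound ξ s k) ^ (B.gens.h - 1) := by
    have := B.lineValBound_nonneg ξ s k
    positivity
  have hΘ : (B.thetaLowc * Real.exp (-(B.thetaLowC * (1 + (s : ℝ) ^ 2)))) ^ (Fintype.card (β ⊕ (γ ⊕ δ)) * D') ≤
      ‖theta B.L B.κM (baseIdx (B.cAt s)) ((s : ℂ) • B.v)‖ ^ (Fintype.card (β ⊕ (γ ⊕ δ)) * D') :=
    pow_le_pow_left₀ (by positivity) (hlow s) _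
  calc ‖extrapFun B.L B.κM (B.auxForm ξ) B.v (B.gridDir cg) k s‖ *
        (|(B.dAt s : ℝ)| ^ B.expE (Fintype.card (β ⊕ (γ ⊕ δ)) * D') k *
          (|(B.dAt s : ℝ)| ^ B.expE (Fintype.card (β ⊕ (γ ⊕ δ)) * D') k * B.lineValBound ξ s k) ^ (B.gens.h - 1))
      ≤ _ := mul_le_mul_of_nonneg_right hφ hΛ
    _ < _ := hnum s hs k hk
    _ ≤ _ := hΘ

end BakerData

end Std

end GaGmE

end Literature.NumberTheory.Transcendental

end
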